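import Summits.Langlands.Langlands.Theorems.IrreducibilityBySelfDualityPairLBoundaryJSGapProjectedAnalyticPart1

/-!
# The projected `GL_n × GL_m` Rankin–Selberg integral `I^ℙ(s; φ, φ')`, `m < n`: absolute convergence,
# holomorphy and vertical-strip bounds GRANTED the two decay estimates of the projected cusp form

Summit `Langlands`, sub-problem `Langlands`, helper file under `Theorems/` supporting the crux
`PairLBoundaryJS` (stmt-Langlands-13622), line `Sketch`, wave 3 (the projector road), registered sub-stub
`stub_gap_proj_analytic` (part 1, the fibre integral, is `GapProjectedAnalyticPart1`). The sections `Uniform` and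
`Global` of `Literature.NumberTheory.Automorphic.JPSSGlobalIntegral` (Cogdell (2004), §2.2 and Thm. 2.1, first
clause) rewritten for the PROJECTED integral of `JPSSProjectedGlobalIntegral`,

  `I^ℙ(s; φ, φ') = jpssProjIntegral hmn μ' φ φ' s = ∫_{X_m} φ'(x) · 𝓚^ℙ_s(x) dμ'(x)`,
  `𝓚^ℙ_s([g]) = jpssProjKernel hmn φ s g⁻¹ = ∫_ℝ Φ_m(ι(z(e^u) g⁻¹)) |det (z(e^u) g⁻¹)|_𝔸^{s - (n-m)/2} du`,

`Φ_m = whittakerDepth m (invQuot φ)` (Cogdell's projector `ℙⁿ_m`, §2.2.1, PDF p. 182: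
`ℙφ(h; 1) = |det h|^{-(n-m-1)/2} Φ_m(diag(h, 1_{n-m}))`, so that
`I(s; φ, φ') = ∫ Φ_m(diag(h, 1)) φ'(h) |det h|^{s-(n-m)/2} dh`), `ι = glCorner`, `z(e^u) = scalarExp m K u`.
The two decay inputs — for the bare corner the theorems `exists_bound_corner_scalarExp` and
`exists_bound_corner_mul` of `CuspFormCornerDecay` (reduction theory) — are HYPOTHESES on `Φ_m`, in exactly those
shapes (what quantitative reduction theory for the projected form supplies):

* (H1) `hdec₁`: for every compact `Ω ⊆ GL_m(𝔸_K)` and `B > 0` there is `C ≥ 0` with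
  `‖Φ_m(ι(z(e^u) g))‖ ≤ C e^{-B|u|}` for `g ∈ Ω`, `u ∈ ℝ`;
* (H2) `hdec₂`: for every `B > 0` there is `C ≥ 0` with
  `‖Φ_m(ι h)‖ · ‖Φ'(h)‖ ≤ C · min(|det h|_𝔸^B, |det h|_𝔸^{-B})` for all `h ∈ GL_m(𝔸_K)` (`Φ' = invQuot φ'`).

Results: `exists_bound_mul_jpssProjKernel` — from (H2), `‖Φ'(h)‖ ‖𝓚^ℙ_s(h)‖ ≤ C` uniformly in `h` and in
`s` in a vertical strip (the substitution `u ↦ u m[K:ℚ] + log |det h|`); hence, with part 1, on the finite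
measure space `X_m` the integrand `φ' · jpssProjFibre φ s` is bounded and continuous:
`integrable_jpssProjIntegral_integrand` (absolute convergence for every `s`), `differentiable_jpssProjIntegral`
(`I^ℙ` is ENTIRE: dominated holomorphic parameter integral), `exists_bound_jpssProjIntegral_strip` (BOUNDED IN
VERTICAL STRIPS) — Cogdell (2004), Thm. 2.1, first clause: "the family of integrals `I(s; φ, φ')` define entire
functions of `s`, bounded in vertical strips" — and the registered conjunction `stub_gap_proj_analytic`.

## References

* J. W. Cogdell, *Analytic theory of L-functions for GL_n*, in J. Bernstein, S. Gelbart (eds.),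
  *An Introduction to the Langlands Program*, Birkhäuser (2004), §2.2 (PDF pp. 181–184), Thm. 2.1
  [CogdellAnalyticTheory2004].
* H. Jacquet, I. I. Piatetski-Shapiro, J. Shalika, *Rankin–Selberg convolutions*, Amer. J. Math.
  105 (1983), 367–464 [JacquetPiatetskiShapiroShalika1983].
-/

noncomputable section

-- `Summit.Langlands.Langlands.…` (summit = sub-problem name, D-0017 layout) trips `dupNamespace`
set_option linter.dupNamespace false

open scoped MatrixGroups Topology Pointwise ENNReal NNReal ComplexConjugate InnerProductSpace ContDiff
-- the place subtypes indexing `mixedSpace K` are `Fintype` classically (`NormedCommRing (mixedSpace K)`)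
open scoped Classical Matrix.Norms.Operator
open NumberField IsDedekindDomain MeasureTheory Measure Matrix Set Filter WithZero
open NumberField.mixedEmbedding
open Literature.NumberTheory.Automorphic AdelicGroupData
open Literature.NumberTheory.GaloisRepresentations (ideleGroup HeckeCharacter)
open Literature.MeasureTheory.Group
open Literature.RingTheory.SymmetricFunctions.SymmPoly
open ValuativeRel
open Summit.Langlands.Langlands.Theorems.GapProjectedAnalyticPart1

-- the automorphic quotient carries the tree's Borel σ-algebra, not Mathlib's quotient σ-algebra
attribute [-instance] Quotient.instMeasurableSpace QuotientGroup.measurableSpace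

-- the house local instances, exactly as in `RankinSelbergUnfoldingIdentity`
attribute [local instance] adelicBorel borelSpace_adelic locallyCompactSpace_adelic secondCountableTopology_gl_adelic
  glAdeleBorel borelSpace_glAdele borelSpace_ideleGroup secondCountableTopology_ideleGroup

-- Mathlib idiom: the commutator Lie ring on matrices, to mention `(archGroupGL n K).lie`
attribute [local instance 100] LieRing.ofAssociativeRing

namespace Summit.Langlands.Langlands.Theorems.GapProjectedAnalytic

/-! ### The uniform bound along the fibres, from the uniform decay estimate (H2) -/

section Uniform

variable {n m : ℕ} {K : Type} [Field K] [NumberField K]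

local notation "𝔸" => AdeleRing (𝓞 K) K

/-- **The uniform bound along the fibres, from (H2).** For `0 < m < n` and a vertical strip
`σ₁ ≤ re s ≤ σ₂` there is `C ≥ 0` with `‖Φ'(h)‖ · ‖jpssProjKernel φ s h‖ ≤ C` for ALL
`h ∈ GL_m(𝔸_K)` and all `s` in the strip (`Φ' = invQuot φ'`): by `A_G`-invariance of `Φ'` and (H2)
with `B = max |σᵢ - (n-m)/2| + 1` the integrand of `Φ'(h) · jpssProjKernel φ s h` at `u` is at most
`C₀ e^{-|w|}`, `w = u m[K:ℚ] + log |det h|`, whose integral over `u` does not depend on `h`.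
[cite: CogdellAnalyticTheory2004, §2.2 (PDF p. 182), Thm. 2.1] -/
theorem exists_bound_mul_jpssProjKernel (hm : 0 < m) (hmn : m < n)
    {φ : (gl n K).automorphicQuotient → ℂ} {φ' : (gl m K).automorphicQuotient → ℂ}
    (hdec₂ : ∀ B : ℝ, 0 < B → ∃ C : ℝ, 0 ≤ C ∧ ∀ h : GL (Fin m) 𝔸,
      ‖whittakerDepth m (invQuot (gl n K) φ) (glCorner 𝔸 hmn.le h)‖ * ‖invQuot (gl m K) φ' h‖ ≤
        C * min ((((glAbsDet m K h : ℝ≥0ˣ) : ℝ≥0) : ℝ) ^ B) ((((glAbsDet m K h : ℝ≥0ˣ) : ℝ≥0) : ℝ) ^ (-B)))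
    (σ₁ σ₂ : ℝ) :
    ∃ C : ℝ, 0 ≤ C ∧ ∀ s : ℂ, σ₁ ≤ s.re → s.re ≤ σ₂ → ∀ h : GL (Fin m) 𝔸,
      ‖invQuot (gl m K) φ' h‖ * ‖jpssProjKernel hmn φ s h‖ ≤ C := by
  set Φ : GL (Fin n) 𝔸 → ℂ := whittakerDepth m (invQuot (gl n K) φ) with hΦ
  set Φ' : GL (Fin m) 𝔸 → ℂ := invQuot (gl m K) φ' with hΦ'
  have hZ' : ∀ z ∈ (posRealScalar m K).range, ∀ g, Φ' (z * g) = Φ' g :=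
    fun z hz g => invQuot_mul_left _ φ' (Subgroup.mem_sup_left hz) g
  set c₀ : ℝ := ((n : ℝ) - (m : ℝ)) / 2 with hc₀
  set E₀ : ℝ := max |σ₁ - c₀| |σ₂ - c₀| with hE₀
  have hE₀0 : 0 ≤ E₀ := le_max_of_le_left (abs_nonneg _)
  set B : ℝ := E₀ + 1 with hB
  have hB0 : 0 < B := by positivity
  obtain ⟨C₀, hC₀0, hC₀⟩ := hdec₂ B hB0
  set D : ℕ := m * Module.finrank ℚ K with hD
  have hD0 : 0 < D := Nat.mul_pos hm Module.finrank_pos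
  have hDr : (0 : ℝ) < D := by exact_mod_cast hD0
  set I₀ : ℝ := ∫ y : ℝ, Real.exp (-(1 : ℝ) * |y|) with hI₀
  have hI₀0 : 0 ≤ I₀ := integral_nonneg fun y => (Real.exp_pos _).le
  refine ⟨C₀ * (D : ℝ)⁻¹ * I₀, by positivity, fun s hs₁ hs₂ h => ?_⟩
  have he : |s.re - c₀| ≤ E₀ := by
    rcases le_or_gt 0 (s.re - c₀) with h0 | h0
    · calc |s.re - c₀| = s.re - c₀ := abs_of_nonneg h0
        _ ≤ |σ₂ - c₀| := by linarith [le_abs_self (σ₂ - c₀)]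
        _ ≤ E₀ := le_max_right _ _
    · calc |s.re - c₀| = -(s.re - c₀) := abs_of_neg h0
        _ ≤ |σ₁ - c₀| := by linarith [neg_le_abs (σ₁ - c₀)]
        _ ≤ E₀ := le_max_left _ _
  set N : ℝ := (((glAbsDet m K h : ℝ≥0ˣ) : ℝ≥0) : ℝ) with hN
  have hN0 : 0 < N := glAbsDet_real_pos h
  set c : ℝ := Real.log N with hc
  have hNc : Real.exp c = N := Real.exp_log hN0
  -- the integrand of `Φ'(h) · jpssProjKernel` and its bound
  set G : ℝ → ℂ := fun u => whittakerDepth m (invQuot (gl n K) φ)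
      (glCorner 𝔸 hmn.le (scalarExp m K u * h)) *
    ((((glAbsDet m K (scalarExp m K u * h) : ℝ≥0ˣ) : ℝ≥0) : ℝ) : ℂ) ^ (s - ((n : ℂ) - (m : ℂ)) / 2) with hG
  set bound : ℝ → ℝ := fun u => C₀ * Real.exp (-(1 : ℝ) * |(D : ℝ) * u + c|) with hbound
  have hptw : ∀ u : ℝ, ‖Φ' h * G u‖ ≤ bound u := by
    intro u
    set w : ℝ := (D : ℝ) * u + c with hw
    have hdet : (((glAbsDet m K (scalarExp m K u * h) : ℝ≥0ˣ) : ℝ≥0) : ℝ) = Real.exp w := by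
      rw [glAbsDet_scalarExp_mul, ← hN, ← hNc, ← Real.exp_add, hw, hD]
      congr 1
      push_cast
      ring
    have hΦ'u : Φ' h = Φ' (scalarExp m K u * h) := (hZ' _ ⟨expUnitNNReal u, rfl⟩ h).symm
    have hude := hC₀ (scalarExp m K u * h)
    rw [hdet, min_exp_mul_exp_neg_mul hB0.le] at hude
    rw [norm_mul, hG, norm_jpssProjIntegrand hmn, ← hc₀, hdet, hΦ'u]
    have h2 : Real.exp w ^ (s.re - c₀) ≤ Real.exp (E₀ * |w|) := by
      rw [← Real.exp_mul]
      refine Real.exp_le_exp.2 ?_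
      calc w * (s.re - c₀) ≤ |w * (s.re - c₀)| := le_abs_self _
        _ = |w| * |s.re - c₀| := abs_mul _ _
        _ ≤ |w| * E₀ := by gcongr
        _ = E₀ * |w| := mul_comm _ _
    calc ‖Φ' (scalarExp m K u * h)‖ *
          (‖Φ (glCorner 𝔸 hmn.le (scalarExp m K u * h))‖ * Real.exp w ^ (s.re - c₀))
        = (‖Φ (glCorner 𝔸 hmn.le (scalarExp m K u * h))‖ *
            ‖Φ' (scalarExp m K u * h)‖) * Real.exp w ^ (s.re - c₀) := by ring
      _ ≤ (C₀ * Real.exp (-B * |w|)) * Real.exp (E₀ * |w|) :=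
          mul_le_mul hude h2 (Real.rpow_nonneg (Real.exp_pos _).le _) (by positivity)
      _ = C₀ * Real.exp (-(1 : ℝ) * |w|) := by
          rw [mul_assoc, ← Real.exp_add, hB]; ring_nf
      _ = bound u := by rw [hbound]
  -- integrability and the value of the integral of the bound
  have hexp : Integrable fun y : ℝ => Real.exp (-(1 : ℝ) * |y|) := integrable_exp_neg_mul_abs_real one_pos
  have hbint : Integrable bound := by
    have h1 : Integrable fun y : ℝ => Real.exp (-(1 : ℝ) * |y + c|) := hexp.comp_add_right c
    have h2 : Integrable fun u : ℝ => Real.exp (-(1 : ℝ) * |(D : ℝ) * u + c|) :=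
      h1.comp_mul_left' hDr.ne'
    exact h2.const_mul C₀
  have hbval : ∫ u, bound u = C₀ * ((D : ℝ)⁻¹ * I₀) := by
    rw [hbound, integral_const_mul]
    congr 1
    have h1 := Measure.integral_comp_mul_left (fun y : ℝ => Real.exp (-(1 : ℝ) * |y + c|)) (D : ℝ)
    rw [h1, abs_of_pos (inv_pos.2 hDr), smul_eq_mul]
    congr 1
    exact integral_add_right_eq_self (μ := volume) (fun y : ℝ => Real.exp (-(1 : ℝ) * |y|)) c
  -- conclusion
  calc ‖Φ' h‖ * ‖jpssProjKernel hmn φ s h‖ = ‖∫ u, Φ' h * G u‖ := by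
        rw [integral_const_mul, norm_mul]
        rfl
    _ ≤ ∫ u, bound u := norm_integral_le_of_norm_le hbint (Eventually.of_forall hptw)
    _ = C₀ * (D : ℝ)⁻¹ * I₀ := by rw [hbval]; ring

end Uniform

/-! ### The projected global integral: absolute convergence, holomorphy, vertical strips -/

section Global

variable {n m : ℕ} {K : Type} [Field K] [NumberField K]

local notation "𝔸" => AdeleRing (𝓞 K) K

/-- The projected fibre integral is continuous on the automorphic quotient. [folklore] -/
theorem continuous_jpssProjFibre (hmn : m < n) {φ : (gl n K).automorphicQuotient → ℂ}
    (hφc : Continuous (invQuot (gl n K) φ))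
    (hdec₁ : ∀ Ω : Set (GL (Fin m) 𝔸), IsCompact Ω → ∀ B : ℝ, 0 < B → ∃ C : ℝ, 0 ≤ C ∧
      ∀ g ∈ Ω, ∀ u : ℝ, ‖whittakerDepth m (invQuot (gl n K) φ) (glCorner 𝔸 hmn.le (scalarExp m K u * g))‖ ≤
        C * Real.exp (-B * |u|))
    (s : ℂ) : Continuous (jpssProjFibre hmn φ s) := by
  refine continuous_of_continuous_invQuot ?_
  rw [jpssProjFibre, AdelicGroupData.invQuot_descend]
  exact continuous_jpssProjKernel hmn hφc hdec₁ s

/-- **Uniform boundedness of the integrand of `I^ℙ(s; φ, φ')` on vertical strips, from (H2)**: there is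
`C` with `‖φ'(x) · jpssProjFibre φ s x‖ ≤ C` for all `x ∈ X_m` and `σ₁ ≤ re s ≤ σ₂`.
[cite: CogdellAnalyticTheory2004, §2.2 (PDF p. 182)] -/
theorem exists_bound_jpssProjIntegral_integrand (hm : 0 < m) (hmn : m < n)
    {φ : (gl n K).automorphicQuotient → ℂ} {φ' : (gl m K).automorphicQuotient → ℂ}
    (hdec₂ : ∀ B : ℝ, 0 < B → ∃ C : ℝ, 0 ≤ C ∧ ∀ h : GL (Fin m) 𝔸,
      ‖whittakerDepth m (invQuot (gl n K) φ) (glCorner 𝔸 hmn.le h)‖ * ‖invQuot (gl m K) φ' h‖ ≤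
        C * min ((((glAbsDet m K h : ℝ≥0ˣ) : ℝ≥0) : ℝ) ^ B) ((((glAbsDet m K h : ℝ≥0ˣ) : ℝ≥0) : ℝ) ^ (-B)))
    (σ₁ σ₂ : ℝ) :
    ∃ C : ℝ, 0 ≤ C ∧ ∀ s : ℂ, σ₁ ≤ s.re → s.re ≤ σ₂ →
      ∀ x : (gl m K).automorphicQuotient, ‖φ' x * jpssProjFibre hmn φ s x‖ ≤ C := by
  obtain ⟨C, hC0, hC⟩ := exists_bound_mul_jpssProjKernel hm hmn hdec₂ σ₁ σ₂
  refine ⟨C, hC0, fun s hs₁ hs₂ x => ?_⟩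
  induction x using QuotientGroup.induction_on with
  | H g =>
    change ‖φ' ((gl m K).toAutomorphicQuotient g) *
      jpssProjFibre hmn φ s ((gl m K).toAutomorphicQuotient g)‖ ≤ C
    have h1 : φ' ((gl m K).toAutomorphicQuotient g) = invQuot (gl m K) φ' g⁻¹ := by
      rw [invQuot_apply, inv_inv]
    rw [norm_mul, h1, jpssProjFibre_toAutomorphicQuotient]
    exact hC s hs₁ hs₂ g⁻¹

variable {μ' : Measure (gl m K).automorphicQuotient}

/-- **Absolute convergence of `I^ℙ(s; φ, φ')` for every `s`** (Cogdell (2004), §2.2, PDF p. 182), from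
continuity of `φ`, `φ'`, (H1) and (H2): the integrand `φ' · jpssProjFibre φ s` is continuous and bounded on
the finite measure space `X_m`. [cite: CogdellAnalyticTheory2004, §2.2 (PDF p. 182), Thm. 2.1] -/
theorem integrable_jpssProjIntegral_integrand [IsFiniteMeasure μ'] (hm : 0 < m) (hmn : m < n)
    {φ : (gl n K).automorphicQuotient → ℂ} (hφc : Continuous φ)
    (hdec₁ : ∀ Ω : Set (GL (Fin m) 𝔸), IsCompact Ω → ∀ B : ℝ, 0 < B → ∃ C : ℝ, 0 ≤ C ∧
      ∀ g ∈ Ω, ∀ u : ℝ, ‖whittakerDepth m (invQuot (gl n K) φ) (glCorner 𝔸 hmn.le (scalarExp m K u * g))‖ ≤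
        C * Real.exp (-B * |u|))
    {φ' : (gl m K).automorphicQuotient → ℂ} (hφ'c : Continuous φ')
    (hdec₂ : ∀ B : ℝ, 0 < B → ∃ C : ℝ, 0 ≤ C ∧ ∀ h : GL (Fin m) 𝔸,
      ‖whittakerDepth m (invQuot (gl n K) φ) (glCorner 𝔸 hmn.le h)‖ * ‖invQuot (gl m K) φ' h‖ ≤
        C * min ((((glAbsDet m K h : ℝ≥0ˣ) : ℝ≥0) : ℝ) ^ B) ((((glAbsDet m K h : ℝ≥0ˣ) : ℝ≥0) : ℝ) ^ (-B)))
    (s : ℂ) : Integrable (fun x => φ' x * jpssProjFibre hmn φ s x) μ' := by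
  obtain ⟨C, -, hC⟩ := exists_bound_jpssProjIntegral_integrand hm hmn hdec₂ s.re s.re
  have hcont : Continuous fun x => φ' x * jpssProjFibre hmn φ s x :=
    hφ'c.mul (continuous_jpssProjFibre hmn (continuous_invQuot_of_continuous_quotient hφc) hdec₁ s)
  exact Integrable.mono' (integrable_const C) hcont.aestronglyMeasurable
    (Eventually.of_forall (hC s le_rfl le_rfl))

/-- **`I^ℙ(s; φ, φ')` is an entire function of `s`** (Cogdell (2004), Thm. 2.1, first clause, PDF p. 184:
"the family of integrals `I(s; φ, φ')` define entire functions of `s`"), granted (H1) and (H2): a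
dominated holomorphic parameter integral over the finite measure space `X_m`, the fibre integrals being
entire (`differentiable_jpssProjKernel`) and the integrand uniformly bounded on unit bands of `re s`
(`exists_bound_jpssProjIntegral_integrand`). [cite: CogdellAnalyticTheory2004, Thm. 2.1 (PDF p. 184)] -/
theorem differentiable_jpssProjIntegral [IsFiniteMeasure μ'] (hm : 0 < m) (hmn : m < n)
    {φ : (gl n K).automorphicQuotient → ℂ} (hφc : Continuous φ)
    (hdec₁ : ∀ Ω : Set (GL (Fin m) 𝔸), IsCompact Ω → ∀ B : ℝ, 0 < B → ∃ C : ℝ, 0 ≤ C ∧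
      ∀ g ∈ Ω, ∀ u : ℝ, ‖whittakerDepth m (invQuot (gl n K) φ) (glCorner 𝔸 hmn.le (scalarExp m K u * g))‖ ≤
        C * Real.exp (-B * |u|))
    {φ' : (gl m K).automorphicQuotient → ℂ} (hφ'c : Continuous φ')
    (hdec₂ : ∀ B : ℝ, 0 < B → ∃ C : ℝ, 0 ≤ C ∧ ∀ h : GL (Fin m) 𝔸,
      ‖whittakerDepth m (invQuot (gl n K) φ) (glCorner 𝔸 hmn.le h)‖ * ‖invQuot (gl m K) φ' h‖ ≤
        C * min ((((glAbsDet m K h : ℝ≥0ˣ) : ℝ≥0) : ℝ) ^ B) ((((glAbsDet m K h : ℝ≥0ˣ) : ℝ≥0) : ℝ) ^ (-B))) :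
    Differentiable ℂ (jpssProjIntegral hmn μ' φ φ') := by
  suffices h : DifferentiableOn ℂ (jpssProjIntegral hmn μ' φ φ') univ from
    fun s => h.differentiableAt (isOpen_univ.mem_nhds (mem_univ s))
  have hφc' := continuous_invQuot_of_continuous_quotient hφc
  refine Literature.Analysis.Complex.differentiableOn_integral_of_dominated (μ := μ') ?_ ?_ ?_
  · intro s _
    exact (integrable_jpssProjIntegral_integrand hm hmn hφc hdec₁ hφ'c hdec₂ s).aestronglyMeasurable
  · refine Eventually.of_forall fun x => ?_
    induction x using QuotientGroup.induction_on with
    | H g =>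
      exact ((differentiable_jpssProjKernel hmn hφc' hdec₁ g⁻¹).const_mul
        (φ' ((gl m K).toAutomorphicQuotient g))).differentiableOn
  · intro s₀ _
    obtain ⟨C, -, hC⟩ := exists_bound_jpssProjIntegral_integrand hm hmn hdec₂ (s₀.re - 1) (s₀.re + 1)
    refine ⟨1, one_pos, subset_univ _, fun _ => C, integrable_const C,
      Eventually.of_forall fun x s hs => ?_⟩
    rw [Metric.mem_ball, dist_eq_norm] at hs
    have h1 : |s.re - s₀.re| ≤ ‖s - s₀‖ := by
      simpa [Complex.sub_re] using Complex.abs_re_le_norm (s - s₀)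
    have h2 := abs_le.mp (h1.trans hs.le)
    exact hC s (by linarith [h2.1]) (by linarith [h2.2]) x

/-- **`I^ℙ(s; φ, φ')` is bounded in vertical strips** (Cogdell (2004), Thm. 2.1, first clause: "entire
functions of `s`, bounded in vertical strips"), granted (H2): `|I^ℙ(s)| ≤ C μ'(X_m)` for `σ₁ ≤ re s ≤ σ₂`.
[cite: CogdellAnalyticTheory2004, Thm. 2.1 (PDF p. 184)] -/
theorem exists_bound_jpssProjIntegral_strip [IsFiniteMeasure μ'] (hm : 0 < m) (hmn : m < n)
    {φ : (gl n K).automorphicQuotient → ℂ} {φ' : (gl m K).automorphicQuotient → ℂ}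
    (hdec₂ : ∀ B : ℝ, 0 < B → ∃ C : ℝ, 0 ≤ C ∧ ∀ h : GL (Fin m) 𝔸,
      ‖whittakerDepth m (invQuot (gl n K) φ) (glCorner 𝔸 hmn.le h)‖ * ‖invQuot (gl m K) φ' h‖ ≤
        C * min ((((glAbsDet m K h : ℝ≥0ˣ) : ℝ≥0) : ℝ) ^ B) ((((glAbsDet m K h : ℝ≥0ˣ) : ℝ≥0) : ℝ) ^ (-B)))
    (σ₁ σ₂ : ℝ) :
    ∃ C : ℝ, 0 ≤ C ∧ ∀ s : ℂ, σ₁ ≤ s.re → s.re ≤ σ₂ → ‖jpssProjIntegral hmn μ' φ φ' s‖ ≤ C := by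
  obtain ⟨C, hC0, hC⟩ := exists_bound_jpssProjIntegral_integrand hm hmn hdec₂ σ₁ σ₂
  refine ⟨C * (μ' univ).toReal, by positivity, fun s hs₁ hs₂ => ?_⟩
  unfold jpssProjIntegral
  calc ‖∫ x, φ' x * jpssProjFibre hmn φ s x ∂μ'‖ ≤ C * (μ' univ).toReal :=
        norm_integral_le_of_norm_le_const (Eventually.of_forall (hC s hs₁ hs₂))
    _ = C * (μ' univ).toReal := rfl

end Global

/-! ### The registered sub-stub -/

/-- **SUB-STUB (wave 3, W2) — Cogdell's Thm. 2.1, first clause, for the projected integral, granted the decay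
estimates.** For `0 < m < n`, continuous `φ` on `GL_n(𝔸_K) ⧸ A_G GL_n(K)` and `φ'` on
`GL_m(𝔸_K) ⧸ A_G GL_m(K)` whose projected form `Φ_m = whittakerDepth m (invQuot φ)` satisfies the compact-set
decay (H1) along the split centre of the corner and, together with `Φ' = invQuot φ'`, the uniform two-sided
decay (H2), and a finite measure `μ'` on `X_m`: the projected Rankin–Selberg integral
`I^ℙ(s; φ, φ') = jpssProjIntegral hmn μ' φ φ' s` is an entire function of `s`, its integrand
`φ' · jpssProjFibre φ s` is absolutely integrable for every `s`, and `I^ℙ` is bounded in every vertical strip.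
[cite: CogdellAnalyticTheory2004, Thm. 2.1 (PDF p. 184)] -/
theorem stub_gap_proj_analytic :
    ∀ {n m : ℕ} {K : Type} [Field K] [NumberField K] (_hm : 0 < m) (hmn : m < n)
      (μ' : Measure (AdelicGroupData.gl m K).automorphicQuotient) [IsFiniteMeasure μ']
      {φ : (AdelicGroupData.gl n K).automorphicQuotient → ℂ}
      {φ' : (AdelicGroupData.gl m K).automorphicQuotient → ℂ},
      Continuous φ → Continuous φ' →
      (∀ Ω : Set (GL (Fin m) (AdeleRing (𝓞 K) K)), IsCompact Ω → ∀ B : ℝ, 0 < B → ∃ C : ℝ, 0 ≤ C ∧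
        ∀ g ∈ Ω, ∀ u : ℝ, ‖whittakerDepth m (invQuot (AdelicGroupData.gl n K) φ)
          (glCorner (AdeleRing (𝓞 K) K) hmn.le (scalarExp m K u * g))‖ ≤ C * Real.exp (-B * |u|)) →
      (∀ B : ℝ, 0 < B → ∃ C : ℝ, 0 ≤ C ∧ ∀ h : GL (Fin m) (AdeleRing (𝓞 K) K),
        ‖whittakerDepth m (invQuot (AdelicGroupData.gl n K) φ) (glCorner (AdeleRing (𝓞 K) K) hmn.le h)‖ *
            ‖invQuot (AdelicGroupData.gl m K) φ' h‖ ≤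
          C * min ((((glAbsDet m K h : ℝ≥0ˣ) : ℝ≥0) : ℝ) ^ B)
            ((((glAbsDet m K h : ℝ≥0ˣ) : ℝ≥0) : ℝ) ^ (-B))) →
      Differentiable ℂ (jpssProjIntegral hmn μ' φ φ') ∧
        (∀ s : ℂ, Integrable (fun x => φ' x * jpssProjFibre hmn φ s x) μ') ∧
        ∀ σ₁ σ₂ : ℝ, ∃ C : ℝ, 0 ≤ C ∧ ∀ s : ℂ, σ₁ ≤ s.re → s.re ≤ σ₂ →
          ‖jpssProjIntegral hmn μ' φ φ' s‖ ≤ C := by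
  intro n m K _ _ hm hmn μ' _ φ φ' hφc hφ'c hdec₁ hdec₂
  exact ⟨differentiable_jpssProjIntegral hm hmn hφc hdec₁ hφ'c hdec₂,
    fun s => integrable_jpssProjIntegral_integrand hm hmn hφc hdec₁ hφ'c hdec₂ s,
    fun σ₁ σ₂ => exists_bound_jpssProjIntegral_strip hm hmn hdec₂ σ₁ σ₂⟩

end Summit.Langlands.Langlands.Theorems.GapProjectedAnalytic
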